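import Mathlib
import Summits.CriticalPhenomena.PercolationContinuityZ3.Theorems.PercNearOneGluingAdditiveGluingBhkSets
import Summits.CriticalPhenomena.PercolationContinuityZ3.Theorems.PercNearOneGluingAdditiveGluingKnThm2GoodAux
import Summits.CriticalPhenomena.PercolationContinuityZ3.Theorems.PercNearOneGluingAdditiveGluingKnThm2GoodEvents
import HarnessLib

/-! # Crux `PercNearOneGluing.AdditiveGluing` (stmt-CriticalPhenomena-4576), line
`replica-splice-at-entrance` — stub `stub_lemma3Split` (the Lemma-3 split)

Helper file for the crux skeleton of the line `replica-splice-at-entrance` (lead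
prover-line-stmt-CriticalPhenomena-4576-c4-0, skeleton v4): proves exactly the registered stub signature
`stub_lemma3Split`; lands with `--supports stmt-CriticalPhenomena-4576`.

## Content

Finite weighted graph on `Fin n` (`μ = prodBernoulli w`, events `{x ↔ y} = openConn x y`), three relays
`a₁, a₂, a₃`, target `b`, observer `o`; designated relay `a₁`, relay `a₂` TIED with it
(`μ(a₂ ↔ b) = μ(a₁ ↔ b)`), leftover relay `a₃`.  With `F := {a₁ ↮ b}`,
`E := {o ↔ a₁ ∨ o ↔ a₂ ∨ o ↔ a₃} ∖ {o ↔ b}` and the events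
`U₀ = {o↔b, b↮a₁, b↮a₂, b↮a₃}`, `R₃ = {o↔b, b↔a₃, b↮a₁, b↮a₂}`, `S₁ = {o↮a₁,a₂,a₃,b, a₁↮b}`,
`P₃ = {o↔a₃, o↮a₁,a₂,b, a₁↔b}`:

`μ(U₀) + μ(R₃) + μ(S₁) − μ(P₃) ≤ μ(F) − μ(E)`.

Proof (the lead's paper proof, `Cruxes/AdditiveGluing/LeadMath-c4.md`):
1. `μ(F) − μ(E) = μ(F ∖ E) − μ(E ∖ F)` (finite additivity);
2. `E ∖ F ⊆ L₂ ∪ P₃` with `L₂ = {a₂↮a₁} ∩ {a₂↔o} ∩ {a₁↔b}` (split on `o ↔ a₂`), so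
   `μ(E ∖ F) ≤ μ(L₂) + μ(P₃)`;
3. `F ∖ E ⊇ U₀ ⊔ R₃ ⊔ R₂ ⊔ S₁` (pairwise disjoint) with `R₂ = {a₂↮a₁} ∩ {a₂↔o} ∩ {a₂↔b}`, so
   `μ(F ∖ E) ≥ μ(U₀) + μ(R₃) + μ(R₂) + μ(S₁)`;
4. Kozma–Nitzan Lemma 3 (i): `μ(L₂) ≤ μ(R₂)` — with `N = {a₂ ↮ a₁}`, the set-BHK tools
   `knThm2_bhkTwo` / `knThm2_bhkOne` (file `…KnThm2GoodAux`, fed by the landed `stub_bhkSets`, sources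
   `S = {a₂}`, `S' = X = {a₁}`) give `μ(N) μ(L₂) ≤ μ(N ∩ a₂o) μ(N ∩ a₁b)` and
   `μ(N ∩ a₂o) μ(N ∩ a₂b) ≤ μ(N) μ(R₂)`, the tie gives `μ(N ∩ a₁b) = μ(N ∩ a₂b)` (on `Nᶜ` the events
   `a₁ ↔ b`, `a₂ ↔ b` coincide); divide by `μ(N)` (if `μ(N) = 0` then `μ(L₂) ≤ μ(N) = 0`);
5. combine.
Only `a₁ ≠ a₂` is used (disjointness of the BHK sources); `b ≠ a₁`, `b ≠ a₂` are carried unused.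
-/

namespace Summit.CriticalPhenomena.PercolationContinuityZ3.Theorems

open MeasureTheory Set
open Literature.Probability.LatticeModels (prodBernoulli)
open Literature.Probability.Percolation (BondConfig openConn openGraph openEdgeCluster)

noncomputable section
open Classical

variable {n : ℕ}

/-! ### The conditioning event `N = {a₂ ↮ a₁}` of the set-BHK tools with singleton sources -/

/-- `{S ↮ S'} = {a₂ ↮ a₁}` for `S = {a₂}`, `S' = {a₁}` (finsets). [folklore] -/
theorem lemma3Split_sep_finset (a₁ a₂ : Fin n) :
    {ω : BondConfig (Fin n) | ∀ s ∈ ({a₂} : Finset (Fin n)), ∀ x ∈ ({a₁} : Finset (Fin n)),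
        ¬ (openGraph ω).Reachable s x} = (openConn a₂ a₁)ᶜ := by
  ext ω
  simp only [Finset.mem_singleton, forall_eq, Set.mem_setOf_eq, Set.mem_compl_iff,
    knThm2_mem_openConn]

/-- `{S ↮ X} = {a₂ ↮ a₁}` for `S = {a₂}`, `X = {a₁} ⊆ V`. [folklore] -/
theorem lemma3Split_sep_set (a₁ a₂ : Fin n) :
    {ω : BondConfig (Fin n) | ∀ s ∈ ({a₂} : Finset (Fin n)), ∀ x ∈ ({a₁} : Set (Fin n)),
        ¬ (openGraph ω).Reachable s x} = (openConn a₂ a₁)ᶜ := by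
  ext ω
  simp only [Finset.mem_singleton, Set.mem_singleton_iff, forall_eq, Set.mem_setOf_eq,
    Set.mem_compl_iff, knThm2_mem_openConn]

/-- On `{a₂ ↔ a₁}` the events `{a₁ ↔ b}` and `{a₂ ↔ b}` coincide:
`{a₁↔b} ∖ {a₂↮a₁} = {a₂↔b} ∖ {a₂↮a₁}`. [folklore] -/
theorem lemma3Split_tie_sets (b a₁ a₂ : Fin n) :
    (openConn a₁ b \ (openConn a₂ a₁)ᶜ : Set (BondConfig (Fin n))) =
      openConn a₂ b \ (openConn a₂ a₁)ᶜ := by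
  ext ω
  simp only [Set.mem_sdiff, Set.mem_compl_iff, not_not, knThm2_mem_openConn]
  constructor
  · rintro ⟨h1b, h21⟩
    exact ⟨h21.trans h1b, h21⟩
  · rintro ⟨h2b, h21⟩
    exact ⟨h21.symm.trans h2b, h21⟩

/-- **The tie on `N = {a₂ ↮ a₁}`**: `μ(a₂↔b) = μ(a₁↔b)` implies `μ(N ∩ a₁b) = μ(N ∩ a₂b)`
(split both by `N`; off `N` the two events coincide). [folklore] -/
theorem lemma3Split_tie (w : Sym2 (Fin n) → unitInterval) (b a₁ a₂ : Fin n)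
    (htie : (prodBernoulli w).real (openConn a₂ b) = (prodBernoulli w).real (openConn a₁ b)) :
    (prodBernoulli w).real ((openConn a₂ a₁)ᶜ ∩ openConn a₁ b : Set (BondConfig (Fin n))) =
      (prodBernoulli w).real ((openConn a₂ a₁)ᶜ ∩ openConn a₂ b : Set (BondConfig (Fin n))) := by
  have hm : ∀ s : Set (BondConfig (Fin n)), MeasurableSet s := fun _ => MeasurableSet.of_discrete
  have e1 := measureReal_inter_add_sdiff (μ := prodBernoulli w) (s := openConn a₁ b)
    (hm (openConn a₂ a₁)ᶜ)
  have e2 := measureReal_inter_add_sdiff (μ := prodBernoulli w) (s := openConn a₂ b)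
    (hm (openConn a₂ a₁)ᶜ)
  rw [lemma3Split_tie_sets] at e1
  rw [Set.inter_comm _ (openConn a₁ b), Set.inter_comm _ (openConn a₂ b)]
  linarith

/-- **Kozma–Nitzan Lemma 3 (i)** (arXiv:2401.12397, p. 6) in the form needed here: with
`N = {a₂ ↮ a₁}` and the tie `μ(a₂↔b) = μ(a₁↔b)`,
`μ(N ∩ {a₂↔o} ∩ {a₁↔b}) ≤ μ(N ∩ {a₂↔o} ∩ {a₂↔b})`.
Proof: BHK two-cluster (`knThm2_bhkTwo`, sources `{a₂}` vs `{a₁}`) gives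
`μ(N) μ(N ∩ a₂o ∩ a₁b) ≤ μ(N ∩ a₂o) μ(N ∩ a₁b)`, BHK one-cluster (`knThm2_bhkOne`, source `{a₂}`
given `{a₂ ↮ a₁}`) gives `μ(N ∩ a₂o) μ(N ∩ a₂b) ≤ μ(N) μ(N ∩ a₂o ∩ a₂b)`, and the tie
`μ(N ∩ a₁b) = μ(N ∩ a₂b)`; divide by `μ(N)`. [cite: KozmaNitzan2024, Lemma 3 (i) (p. 6)] -/
theorem lemma3Split_knLemma3i (w : Sym2 (Fin n) → unitInterval) (o b a₁ a₂ : Fin n)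
    (h12 : a₁ ≠ a₂)
    (htie : (prodBernoulli w).real (openConn a₂ b) = (prodBernoulli w).real (openConn a₁ b)) :
    (prodBernoulli w).real
        ((openConn a₂ a₁)ᶜ ∩ (openConn a₂ o ∩ openConn a₁ b) : Set (BondConfig (Fin n))) ≤
      (prodBernoulli w).real
        ((openConn a₂ a₁)ᶜ ∩ (openConn a₂ o ∩ openConn a₂ b) : Set (BondConfig (Fin n))) := by
  have hSS' : Disjoint ({a₂} : Finset (Fin n)) {a₁} :=
    Finset.disjoint_singleton_left.2 fun h => h12 (Finset.mem_singleton.1 h).symm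
  have hSX : ∀ s ∈ ({a₂} : Finset (Fin n)), s ∉ ({a₁} : Set (Fin n)) := fun s hs hx =>
    h12 ((Set.mem_singleton_iff.1 hx).symm.trans (Finset.mem_singleton.1 hs))
  have i2 := knThm2_bhkTwo stub_bhkSets.2 w {a₂} {a₁} o b hSS'
  have i1 := knThm2_bhkOne stub_bhkSets.1 w {a₂} ({a₁} : Set (Fin n)) o b hSX
  rw [lemma3Split_sep_finset, Finset.set_biUnion_singleton, Finset.set_biInter_singleton] at i2
  rw [lemma3Split_sep_set, Finset.set_biUnion_singleton, Finset.set_biInter_singleton] at i1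
  have htie' := lemma3Split_tie w b a₁ a₂ htie
  rw [htie'] at i2
  have key := i2.trans i1
  rcases (measureReal_nonneg (μ := prodBernoulli w)
      (s := ((openConn a₂ a₁)ᶜ : Set (BondConfig (Fin n))))).eq_or_lt with h0 | hpos
  · calc (prodBernoulli w).real
          ((openConn a₂ a₁)ᶜ ∩ (openConn a₂ o ∩ openConn a₁ b) : Set (BondConfig (Fin n)))
        ≤ (prodBernoulli w).real ((openConn a₂ a₁)ᶜ : Set (BondConfig (Fin n))) :=
          measureReal_mono Set.inter_subset_left
      _ = 0 := h0.symm
      _ ≤ _ := measureReal_nonneg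
  · exact le_of_mul_le_mul_left key hpos

/-! ### Event bookkeeping -/

/-- `E ∖ F ⊆ L₂ ∪ P₃`: on `{o↔A} ∩ {o↮b} ∩ {a₁↔b}` one has `o ↮ a₁`; if `o ↔ a₂` then `a₂ ↮ a₁`
(else `o ↔ b`), if `o ↮ a₂` then `o ↔ a₃`. [folklore] -/
theorem lemma3Split_sdiff_subset (o b a₁ a₂ a₃ : Fin n) :
    (((openConn o a₁ ∪ openConn o a₂ ∪ openConn o a₃) \ openConn o b) \ (openConn a₁ b)ᶜ :
        Set (BondConfig (Fin n))) ⊆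
      (openConn a₂ a₁)ᶜ ∩ (openConn a₂ o ∩ openConn a₁ b) ∪
        openConn o a₃ ∩ (openConn o a₁)ᶜ ∩ (openConn o a₂)ᶜ ∩ (openConn o b)ᶜ ∩ openConn a₁ b := by
  intro ω hω
  simp only [Set.mem_sdiff, Set.mem_union, Set.mem_compl_iff, not_not, knThm2_mem_openConn]
    at hω
  simp only [Set.mem_union, Set.mem_inter_iff, Set.mem_compl_iff, knThm2_mem_openConn]
  obtain ⟨⟨hA, hob⟩, h1b⟩ := hω
  have h1 : ¬ (openGraph ω).Reachable o a₁ := fun h => hob (h.trans h1b)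
  by_cases h2 : (openGraph ω).Reachable o a₂
  · exact Or.inl ⟨fun h21 => hob ((h2.trans h21).trans h1b), h2.symm, h1b⟩
  · have h3 : (openGraph ω).Reachable o a₃ := by
      rcases hA with (h | h) | h
      exacts [absurd h h1, absurd h h2, h]
    exact Or.inr ⟨⟨⟨⟨h3, h1⟩, h2⟩, hob⟩, h1b⟩

/-- `U₀ ⊔ R₃ ⊔ R₂ ⊔ S₁ ⊆ F ∖ E`: each of the four events has `a₁ ↮ b`, the first three have
`o ↔ b` and the last has `o` joined to no relay. [folklore] -/
theorem lemma3Split_union_subset (o b a₁ a₂ a₃ : Fin n) :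
    (openConn o b ∩ (openConn b a₁)ᶜ ∩ (openConn b a₂)ᶜ ∩ (openConn b a₃)ᶜ ∪
          openConn o b ∩ openConn b a₃ ∩ (openConn b a₁)ᶜ ∩ (openConn b a₂)ᶜ ∪
          (openConn a₂ a₁)ᶜ ∩ (openConn a₂ o ∩ openConn a₂ b) ∪
          (openConn o a₁)ᶜ ∩ (openConn o a₂)ᶜ ∩ (openConn o a₃)ᶜ ∩ (openConn o b)ᶜ ∩
            (openConn a₁ b)ᶜ : Set (BondConfig (Fin n))) ⊆
      (openConn a₁ b)ᶜ \ ((openConn o a₁ ∪ openConn o a₂ ∪ openConn o a₃) \ openConn o b) := by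
  intro ω hω
  simp only [Set.mem_union, Set.mem_inter_iff, Set.mem_compl_iff, knThm2_mem_openConn] at hω
  simp only [Set.mem_sdiff, Set.mem_union, Set.mem_compl_iff, knThm2_mem_openConn, not_and,
    not_not]
  rcases hω with ((hU | hR) | hR₂) | hS
  · obtain ⟨⟨⟨hob, hb1⟩, -⟩, -⟩ := hU
    exact ⟨fun h => hb1 h.symm, fun _ => hob⟩
  · obtain ⟨⟨⟨hob, -⟩, hb1⟩, -⟩ := hR
    exact ⟨fun h => hb1 h.symm, fun _ => hob⟩
  · obtain ⟨h21, h2o, h2b⟩ := hR₂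
    exact ⟨fun h => h21 (h2b.trans h.symm), fun _ => h2o.symm.trans h2b⟩
  · obtain ⟨⟨⟨⟨h1, h2⟩, h3⟩, -⟩, h1b⟩ := hS
    refine ⟨h1b, fun h => ?_⟩
    rcases h with (h | h) | h
    exacts [absurd h h1, absurd h h2, absurd h h3]

/-- `U₀` and `R₃` are disjoint (status of `b ↔ a₃`). [folklore] -/
theorem lemma3Split_disj₁ (o b a₁ a₂ a₃ : Fin n) :
    Disjoint (openConn o b ∩ (openConn b a₁)ᶜ ∩ (openConn b a₂)ᶜ ∩ (openConn b a₃)ᶜ :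
        Set (BondConfig (Fin n)))
      (openConn o b ∩ openConn b a₃ ∩ (openConn b a₁)ᶜ ∩ (openConn b a₂)ᶜ) := by
  rw [Set.disjoint_left]
  intro ω hU hR
  simp only [Set.mem_inter_iff, Set.mem_compl_iff, knThm2_mem_openConn] at hU hR
  exact hU.2 hR.1.1.2

/-- `U₀ ⊔ R₃` and `R₂` are disjoint (status of `b ↔ a₂`). [folklore] -/
theorem lemma3Split_disj₂ (o b a₁ a₂ a₃ : Fin n) :
    Disjoint (openConn o b ∩ (openConn b a₁)ᶜ ∩ (openConn b a₂)ᶜ ∩ (openConn b a₃)ᶜ ∪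
          openConn o b ∩ openConn b a₃ ∩ (openConn b a₁)ᶜ ∩ (openConn b a₂)ᶜ :
        Set (BondConfig (Fin n)))
      ((openConn a₂ a₁)ᶜ ∩ (openConn a₂ o ∩ openConn a₂ b)) := by
  rw [Set.disjoint_left]
  intro ω hUR hR₂
  simp only [Set.mem_union, Set.mem_inter_iff, Set.mem_compl_iff, knThm2_mem_openConn]
    at hUR hR₂
  rcases hUR with hU | hR
  · exact hU.1.2 hR₂.2.2.symm
  · exact hR.2 hR₂.2.2.symm

/-- `U₀ ⊔ R₃ ⊔ R₂` and `S₁` are disjoint (status of `o ↔ b`, resp. `o ↔ a₂`). [folklore] -/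
theorem lemma3Split_disj₃ (o b a₁ a₂ a₃ : Fin n) :
    Disjoint (openConn o b ∩ (openConn b a₁)ᶜ ∩ (openConn b a₂)ᶜ ∩ (openConn b a₃)ᶜ ∪
          openConn o b ∩ openConn b a₃ ∩ (openConn b a₁)ᶜ ∩ (openConn b a₂)ᶜ ∪
          (openConn a₂ a₁)ᶜ ∩ (openConn a₂ o ∩ openConn a₂ b) : Set (BondConfig (Fin n)))
      ((openConn o a₁)ᶜ ∩ (openConn o a₂)ᶜ ∩ (openConn o a₃)ᶜ ∩ (openConn o b)ᶜ ∩
        (openConn a₁ b)ᶜ) := by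
  rw [Set.disjoint_left]
  intro ω hURR hS
  simp only [Set.mem_union, Set.mem_inter_iff, Set.mem_compl_iff, knThm2_mem_openConn]
    at hURR hS
  rcases hURR with (hU | hR) | hR₂
  · exact hS.1.2 hU.1.1.1
  · exact hS.1.2 hR.1.1.1
  · exact hS.1.1.1.2 hR₂.2.1.symm

/-! ### Assembly -/

/-- **The Lemma-3 split of the gluing slack** — exactly the registered stub `stub_lemma3Split` of the
line `replica-splice-at-entrance` (skeleton v4).  For the designated relay `a₁`, the relay `a₂` tied
with it (`μ(a₂↔b) = μ(a₁↔b)`) and the leftover relay `a₃`: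
`u + ρ₃ + S₁ − P₃ ≤ μ(a₁ ↮ b) − μ(E)`, `E = {o↔a₁ ∨ o↔a₂ ∨ o↔a₃} ∖ {o↔b}`, where
`u = μ(o↔b, b↮a₁,a₂,a₃)`, `ρ₃ = μ(o↔b↔a₃, b↮a₁,a₂)`, `S₁ = μ(o↮a₁,a₂,a₃,b, a₁↮b)`,
`P₃ = μ(o↔a₃, o↮a₁,a₂,b, a₁↔b)`.
Proof: `μ(F) − μ(E) = μ(F ∖ E) − μ(E ∖ F)` (`F = {a₁↮b}`);
`F ∖ E ⊇ U₀ ⊔ R₃ ⊔ R₂ ⊔ S₁` with `R₂ = {a₂↮a₁, a₂↔o, a₂↔b}`; `E ∖ F ⊆ L₂ ∪ P₃` with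
`L₂ = {a₂↮a₁, a₂↔o, a₁↔b}`; and Kozma–Nitzan Lemma 3 (i) `μ(L₂) ≤ μ(R₂)`
(`lemma3Split_knLemma3i`, from the landed set-BHK theorem `stub_bhkSets`).
[cite: KozmaNitzan2024, Lemma 3 (i) (p. 6)] -/
theorem stub_lemma3Split :
    ∀ (n : ℕ) (w : Sym2 (Fin n) → unitInterval) (o b a₁ a₂ a₃ : Fin n), a₁ ≠ a₂ → b ≠ a₁ → b ≠ a₂ →
      (prodBernoulli w).real (openConn a₂ b) = (prodBernoulli w).real (openConn a₁ b) →
      (prodBernoulli w).real (openConn o b ∩ (openConn b a₁)ᶜ ∩ (openConn b a₂)ᶜ ∩ (openConn b a₃)ᶜ) +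
          (prodBernoulli w).real (openConn o b ∩ openConn b a₃ ∩ (openConn b a₁)ᶜ ∩ (openConn b a₂)ᶜ) +
          (prodBernoulli w).real ((openConn o a₁)ᶜ ∩ (openConn o a₂)ᶜ ∩ (openConn o a₃)ᶜ ∩ (openConn o b)ᶜ ∩ (openConn a₁ b)ᶜ) -
          (prodBernoulli w).real (openConn o a₃ ∩ (openConn o a₁)ᶜ ∩ (openConn o a₂)ᶜ ∩ (openConn o b)ᶜ ∩ openConn a₁ b) ≤
        (prodBernoulli w).real ((openConn a₁ b)ᶜ) -
          (prodBernoulli w).real ((openConn o a₁ ∪ openConn o a₂ ∪ openConn o a₃) \ openConn o b) := by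
  intro n w o b a₁ a₂ a₃ h12 _hb1 _hb2 htie
  have hm : ∀ s : Set (BondConfig (Fin n)), MeasurableSet s := fun _ => MeasurableSet.of_discrete
  -- (1) `μ(F) − μ(E) = μ(F ∖ E) − μ(E ∖ F)`
  have hF := measureReal_inter_add_sdiff (μ := prodBernoulli w)
    (s := ((openConn a₁ b)ᶜ : Set (BondConfig (Fin n))))
    (hm ((openConn o a₁ ∪ openConn o a₂ ∪ openConn o a₃) \ openConn o b))
  have hE := measureReal_inter_add_sdiff (μ := prodBernoulli w)
    (s := ((openConn o a₁ ∪ openConn o a₂ ∪ openConn o a₃) \ openConn o b :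
      Set (BondConfig (Fin n))))
    (hm (openConn a₁ b)ᶜ)
  have hc : (prodBernoulli w).real
      (((openConn o a₁ ∪ openConn o a₂ ∪ openConn o a₃) \ openConn o b) ∩ (openConn a₁ b)ᶜ :
        Set (BondConfig (Fin n))) =
      (prodBernoulli w).real ((openConn a₁ b)ᶜ ∩
        ((openConn o a₁ ∪ openConn o a₂ ∪ openConn o a₃) \ openConn o b) :
          Set (BondConfig (Fin n))) := by
    rw [Set.inter_comm]
  -- (2) `μ(E ∖ F) ≤ μ(L₂) + μ(P₃)`
  have h2 := (measureReal_mono (μ := prodBernoulli w) (lemma3Split_sdiff_subset o b a₁ a₂ a₃)).trans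
    (measureReal_union_le _ _)
  -- (3) `μ(U₀) + μ(R₃) + μ(R₂) + μ(S₁) ≤ μ(F ∖ E)`
  have h3 := measureReal_mono (μ := prodBernoulli w) (lemma3Split_union_subset o b a₁ a₂ a₃)
  rw [measureReal_union (lemma3Split_disj₃ o b a₁ a₂ a₃) (hm _),
    measureReal_union (lemma3Split_disj₂ o b a₁ a₂ a₃) (hm _),
    measureReal_union (lemma3Split_disj₁ o b a₁ a₂ a₃) (hm _)] at h3
  -- (4) KN Lemma 3 (i): `μ(L₂) ≤ μ(R₂)`
  have h4 := lemma3Split_knLemma3i w o b a₁ a₂ h12 htie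
  linarith

end

end Summit.CriticalPhenomena.PercolationContinuityZ3.Theorems
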